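import Mathlib
import Summits.KontsevichZagierPeriods.Zeta5Search.Elimination.UpCone
import HarnessLib

/-!
# ζ(5) search — class `elim`: THE UP-CONE THEOREM MADE INTRINSIC (two box points with the same leading entry are up-cone
# partners of their MEET) + a RANK REMARK on what such span statements are worth (`pub-zeta5`, fam-elim, E-L16)

HONEST FRAMING: systematic search; no irrationality claim unless certified.

OUR work (Summit side; `families/elim/FAMILY.md` §17.13–§17.14).  E-L15 (`UpCone.lean`) put the `ζ(3)`-eliminant
`E(x, y) = W(y)F̃₇(x) − W(x)F̃₇(y)` (`pairElim`) of two up-cone partners of a BASE `b` in the `ℚ`-span of the consecutive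
diagonal eliminants `partnerElim (b^{(m)}) i` (pivots `W(b^{(m)}) ≠ 0` as hypotheses) and called down-shifts "outside the
cone" — too cautious: slot shifts never move `b₀` (`upList_zero`), so for ANY `b′, b″` in the box with `b′₀ = b″₀` and
`d(b′), d(b″) ≥ −1` the slotwise minimum `a = b′ ∧ b″` (`meet`) is a base reaching both along admissible paths (`pathOf`,
`upList_pathOf`, `pathAdm_pathOf`); with `N = d(a) − min(d(b′), d(b″))` (`meetDepth_eq`) and pivots `W(a^{(m)}) ≠ 0`, `0 < m < N`:
  `W(b″)F̃₇(b′) − W(b′)F̃₇(b″) ∈ Σ_{m<N} ℚ·(Q(a^{(m)})ζ(5) − P(a^{(m)}))`  (`slice_elim_mem_diagSpan`, `slice_elim_mem_partnerSpan`).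
Down-shift pairs `(b, b − e_{i+1})` are contiguous pairs at the base `b − e_{i+1}` (`pairElim_up_base`, depth 1), mixed
pairs `(b + e_{i+1}, b − e_{k+1})` are second-shell pairs (E-L13) at `b − e_{k+1}`, and EVEN distance `2r` in `b₀` reduces
the same way, `a = b′ ∧ (b″ − r(2;1,…,1))` (`shifted_elim_mem_diagSpan`, `shiftDepth_eq`).  Not reached by (DS): odd
distance in `b₀`, reflections of the box.

RANK REMARK (honest framing).  As bare propositions these memberships, and those of E-L13/E-L15, are CHEAP once `N ≥ 2`:
a `ζ(3)`-eliminant of two decomposed forms is a two-term form `Aζ(5) − B`, `A, B ∈ ℚ` (`pairElim_eq`), and two diagonal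
eliminants `Q₀ζ(5) − P₀`, `Q₁ζ(5) − P₁` with `Q₀P₁ ≠ Q₁P₀` span `ℚζ(5) + ℚ` over `ℚ` (`twoTerm_mem_of_pair_mem`, Cramer):
ONE non-vanishing Casoratian puts the eliminant of ANY two points of the decomposition region — partners or not, odd
distance and reflections included — in `diagSpan a 2` (`pairElim_mem_diagSpan_two_of_casoratian`).  The CONTENT of the
up-cone files is therefore (α) the IDENTITIES: `flag_expansion` / `pairElim_upList` hold for every solution of (DS) in
any `ℚ`-module, and the reduction to consecutive eliminants is the telescoping of `E(x,y)/(W(x)W(y)) = F̃₇(x)/W(x) − F̃₇(y)/W(y)`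
(`pairElim_cyclic`), so the coefficients are flag coefficients times pivot ratios and no Casoratian enters; (β) the
rank-ONE depths `N ≤ 1` (E-L10/E-L12: the eliminant is a rational MULTIPLE of ONE Brown–Zudilin form — the type-I
relation); (γ) "inside / outside (DS)" is about identities, not spans.  NOT claimed: sizes, denominators, valuations,
irrationality; pivots and Casoratian are HYPOTHESES; entries beyond slot 7 are inert (slice points agree there, `hoff`).
-/

noncomputable section

open Finset

namespace Summit.KontsevichZagierPeriods.Zeta5Search.Elimination

open Summit.KontsevichZagierPeriods.Zeta5Search.DualSeries (InBox)
open Summit.KontsevichZagierPeriods.Zeta5Search.WedgeDictionary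
open Literature.NumberTheory.Irrationality.BrownZudilin2022 (vwpDual)

/-! ### Canonical slot paths -/

/-- The slot list raising slot `k+1` exactly `n k` times for every `k < K`:
`repSlots n K = replicate (n (K−1)) (K−1) ++ ⋯ ++ replicate (n 0) 0`. -/
def repSlots (n : ℕ → ℕ) : ℕ → List ℕ
  | 0 => []
  | K + 1 => List.replicate (n K) K ++ repSlots n K

/-- Every entry of `repSlots n K` is a slot `< K`. -/
theorem mem_repSlots_lt {n : ℕ → ℕ} {K j : ℕ} (h : j ∈ repSlots n K) : j < K := by
  induction K with
  | zero => simp [repSlots] at h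
  | succ K ih =>
    simp only [repSlots, List.mem_append, List.mem_replicate] at h
    rcases h with ⟨-, rfl⟩ | h
    · exact Nat.lt_succ_self _
    · exact Nat.lt_succ_of_lt (ih h)

/-- Slot `j` occurs `n j` times in `repSlots n K` if `j < K`, and not at all otherwise. -/
theorem count_repSlots (n : ℕ → ℕ) (K j : ℕ) : (repSlots n K).count j = if j < K then n j else 0 := by
  induction K with
  | zero => simp [repSlots]
  | succ K ih =>
    rw [repSlots, List.count_append, ih, List.count_replicate]
    by_cases hjK : j < K
    · have h1 : j < K + 1 := by omega
      have h2 : ¬ (K == j) = true := by simp; omega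
      simp [hjK, h1, h2]
    · by_cases hj : j = K
      · subst hj; simp
      · have h1 : ¬ j < K + 1 := by omega
        have h2 : ¬ (K == j) = true := by simp; exact fun h => hj h.symm
        simp [hjK, h1, h2]

/-- The CANONICAL PATH from `a` up to `x`: raise slot `k+1` by `(x_{k+1} − a_{k+1})⁺`, `k < 7`. -/
def pathOf (a x : ℕ → ℤ) : List ℕ := repSlots (fun k => (x (k + 1) - a (k + 1)).toNat) 7

/-- Multiplicity of slot `j < 7` in the canonical path. -/
theorem count_pathOf (a x : ℕ → ℤ) {j : ℕ} (hj : j < 7) :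
    ((pathOf a x).count j : ℤ) = ((x (j + 1) - a (j + 1)).toNat : ℤ) := by
  unfold pathOf; rw [count_repSlots]; simp [hj]

/-- Slots `≥ 7` are not visited. -/
theorem count_pathOf_of_le (a x : ℕ → ℤ) {j : ℕ} (hj : 7 ≤ j) : (pathOf a x).count j = 0 := by
  unfold pathOf; rw [count_repSlots]; simp [show ¬ j < 7 by omega]

/-- **The canonical path reaches `x` from `a`** whenever `a ≤ x` on the slots, `a₀ = x₀`, and the two agree beyond slot 7. -/
theorem upList_pathOf {a x : ℕ → ℤ} (h0 : a 0 = x 0) (hle : ∀ j ∈ range 7, a (j + 1) ≤ x (j + 1))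
    (hoff : ∀ j, 8 ≤ j → a j = x j) : upList a (pathOf a x) = x := by
  funext j
  cases j with
  | zero => rw [upList_zero, h0]
  | succ k =>
    rw [upList_succ]
    by_cases hk : k < 7
    · rw [count_pathOf a x hk, Int.toNat_of_nonneg (by have := hle k (mem_range.2 hk); omega)]; ring
    · rw [count_pathOf_of_le a x (by omega), hoff (k + 1) (by omega)]; simp

/-- Length of the canonical path = drop in excess: `|pathOf a x| = d(a) − d(x)` (under the hypotheses of `upList_pathOf`). -/
theorem length_pathOf {a x : ℕ → ℤ} (h0 : a 0 = x 0) (hle : ∀ j ∈ range 7, a (j + 1) ≤ x (j + 1))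
    (hoff : ∀ j, 8 ≤ j → a j = x j) : ((pathOf a x).length : ℤ) = dOf a - dOf x := by
  have h := dOf_upList a (pathOf a x) (fun i hi => mem_repSlots_lt hi)
  rw [upList_pathOf h0 hle hoff] at h
  omega

/-- **Room for the canonical path**: if `a` and `x` are in the box, `a ≤ x` on the slots with `a₀ = x₀`, and `d(x) ≥ −1`,
then `pathOf a x` is admissible at `a` (`PathAdm`). -/
theorem pathAdm_pathOf {a x : ℕ → ℤ} (ha : InBox a) (hx : InBox x) (h0 : a 0 = x 0)
    (hle : ∀ j ∈ range 7, a (j + 1) ≤ x (j + 1)) (hoff : ∀ j, 8 ≤ j → a j = x j) (hdx : -1 ≤ dOf x) :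
    PathAdm a (pathOf a x) := by
  refine ⟨ha, ?_, fun i hi => mem_repSlots_lt hi, fun i hi => ?_⟩
  · rw [length_pathOf h0 hle hoff]; omega
  · have hi7 : i < 7 := mem_repSlots_lt hi
    rw [count_pathOf a x hi7, Int.toNat_of_nonneg (by have := hle i (mem_range.2 hi7); omega)]
    have := (hx.2 i (mem_range.2 hi7)).2
    omega

/-! ### The meet of two points of a slice `{b₀ = const}` -/

/-- The MEET `b′ ∧ b″`: coordinatewise minimum on the slots `1, …, 7`, `b′` elsewhere. -/
def meet (b' b'' : ℕ → ℤ) : ℕ → ℤ := fun j => if 1 ≤ j ∧ j ≤ 7 then min (b' j) (b'' j) else b' j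

/-- The meet keeps the leading entry. -/
@[simp] theorem meet_zero (b' b'' : ℕ → ℤ) : meet b' b'' 0 = b' 0 := by simp [meet]

/-- On the slots the meet is the minimum. -/
theorem meet_succ (b' b'' : ℕ → ℤ) {j : ℕ} (hj : j ∈ range 7) :
    meet b' b'' (j + 1) = min (b' (j + 1)) (b'' (j + 1)) := by
  have := mem_range.1 hj
  simp [meet, show j + 1 ≤ 7 by omega]

/-- Beyond slot 7 (inert entries) the meet is `b′`. -/
theorem meet_of_le (b' b'' : ℕ → ℤ) {j : ℕ} (hj : 8 ≤ j) : meet b' b'' j = b' j := by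
  simp [meet, show ¬ j ≤ 7 by omega]

/-- The meet of two box points with the same leading entry is in the box. -/
theorem inBox_meet {b' b'' : ℕ → ℤ} (hb' : InBox b') (hb'' : InBox b'') : InBox (meet b' b'') := by
  refine ⟨by rw [meet_zero]; exact hb'.1, fun j hj => ?_⟩
  rw [meet_succ b' b'' hj, meet_zero]
  obtain ⟨h1, h2⟩ := hb'.2 j hj
  obtain ⟨h3, h4⟩ := hb''.2 j hj
  constructor
  · exact le_min h1 h3
  · exact (min_le_left _ _).trans h2

/-- The excess of the meet dominates both excesses. -/
theorem dOf_le_dOf_meet {b' b'' : ℕ → ℤ} (h0 : b' 0 = b'' 0) :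
    dOf b' ≤ dOf (meet b' b'') ∧ dOf b'' ≤ dOf (meet b' b'') := by
  unfold dOf
  rw [meet_zero]
  have h1 : ∑ j ∈ range 7, meet b' b'' (j + 1) ≤ ∑ j ∈ range 7, b' (j + 1) :=
    sum_le_sum fun j hj => by rw [meet_succ b' b'' hj]; exact min_le_left _ _
  have h2 : ∑ j ∈ range 7, meet b' b'' (j + 1) ≤ ∑ j ∈ range 7, b'' (j + 1) :=
    sum_le_sum fun j hj => by rw [meet_succ b' b'' hj]; exact min_le_right _ _
  constructor <;> omega

/-- Both points are reached from the meet along canonical admissible paths. -/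
theorem meet_paths {b' b'' : ℕ → ℤ} (hb' : InBox b') (hb'' : InBox b'') (h0 : b' 0 = b'' 0)
    (hoff : ∀ j, 8 ≤ j → b' j = b'' j) (hd' : -1 ≤ dOf b') (hd'' : -1 ≤ dOf b'') :
    upList (meet b' b'') (pathOf (meet b' b'') b') = b' ∧ upList (meet b' b'') (pathOf (meet b' b'') b'') = b'' ∧
      PathAdm (meet b' b'') (pathOf (meet b' b'') b') ∧ PathAdm (meet b' b'') (pathOf (meet b' b'') b'') := by
  have ha := inBox_meet hb' hb''
  have hle' : ∀ j ∈ range 7, meet b' b'' (j + 1) ≤ b' (j + 1) := fun j hj => by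
    rw [meet_succ b' b'' hj]; exact min_le_left _ _
  have hle'' : ∀ j ∈ range 7, meet b' b'' (j + 1) ≤ b'' (j + 1) := fun j hj => by
    rw [meet_succ b' b'' hj]; exact min_le_right _ _
  have hoff' : ∀ j, 8 ≤ j → meet b' b'' j = b' j := fun j hj => meet_of_le b' b'' hj
  have hoff'' : ∀ j, 8 ≤ j → meet b' b'' j = b'' j := fun j hj => by rw [meet_of_le b' b'' hj, hoff j hj]
  have h0' : meet b' b'' 0 = b' 0 := meet_zero b' b''
  have h0'' : meet b' b'' 0 = b'' 0 := by rw [meet_zero, h0]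
  exact ⟨upList_pathOf h0' hle' hoff', upList_pathOf h0'' hle'' hoff'',
    pathAdm_pathOf ha hb' h0' hle' hoff' hd', pathAdm_pathOf ha hb'' h0'' hle'' hoff'' hd''⟩

/-- The DEPTH of the pair: the number of consecutive diagonal eliminants of the meet that the reduction uses,
`N = max(|pathOf a b′|, |pathOf a b″|)`. -/
def meetDepth (b' b'' : ℕ → ℤ) : ℕ :=
  max (pathOf (meet b' b'') b').length (pathOf (meet b' b'') b'').length

/-- `N = d(a) − min(d(b′), d(b″))` for the meet `a`. -/
theorem meetDepth_eq {b' b'' : ℕ → ℤ} (h0 : b' 0 = b'' 0) (hoff : ∀ j, 8 ≤ j → b' j = b'' j) :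
    (meetDepth b' b'' : ℤ) = dOf (meet b' b'') - min (dOf b') (dOf b'') := by
  have hle' : ∀ j ∈ range 7, meet b' b'' (j + 1) ≤ b' (j + 1) := fun j hj => by
    rw [meet_succ b' b'' hj]; exact min_le_left _ _
  have hle'' : ∀ j ∈ range 7, meet b' b'' (j + 1) ≤ b'' (j + 1) := fun j hj => by
    rw [meet_succ b' b'' hj]; exact min_le_right _ _
  have h1 := length_pathOf (meet_zero b' b'') hle' (fun j hj => meet_of_le b' b'' hj)
  have h2 := length_pathOf (a := meet b' b'') (x := b'') (by rw [meet_zero, h0]) hle''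
    (fun j hj => by rw [meet_of_le b' b'' hj, hoff j hj])
  unfold meetDepth
  push_cast
  rw [h1, h2]
  rcases le_total (dOf b') (dOf b'') with h | h
  · rw [min_eq_left h, max_eq_left (by omega)]
  · rw [min_eq_right h, max_eq_right (by omega)]

/-! ### The slice theorem -/

/-- **THE UP-CONE THEOREM, INTRINSIC FORM (span of the consecutive diagonal eliminants of the meet).** For any two points
`b′, b″` of the box with the same leading entry (agreeing beyond slot 7), `d(b′), d(b″) ≥ −1`, and non-vanishing pivots
`W(a^{(m)})`, `0 < m < N`, at the meet `a = b′ ∧ b″`:  `W(b″)F̃₇(b′) − W(b′)F̃₇(b″) ∈ ⟨diagElim a^{(m)} : m < N⟩_ℚ`. -/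
theorem slice_elim_mem_diagSpan {b' b'' : ℕ → ℤ} (hb' : InBox b') (hb'' : InBox b'') (h0 : b' 0 = b'' 0)
    (hoff : ∀ j, 8 ≤ j → b' j = b'' j) (hd' : -1 ≤ dOf b') (hd'' : -1 ≤ dOf b'')
    (hW : ∀ m, 0 < m → m < meetDepth b' b'' → coeffW (dsShift^[m] (meet b' b'')) ≠ 0) :
    pairElim b' b'' ∈ diagSpan (meet b' b'') (meetDepth b' b'') := by
  obtain ⟨h1, h2, hp, hq⟩ := meet_paths hb' hb'' h0 hoff hd' hd''
  have h := upCone_elim_mem_diagSpan hp hq hW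
  rwa [h1, h2] at h

/-- **THE UP-CONE THEOREM, INTRINSIC FORM (Brown–Zudilin reading).** Under the same hypotheses and for any slot `i`
admissible at the meet `a`:  `W(b″)F̃₇(b′) − W(b′)F̃₇(b″) ∈ Σ_{m < N} ℚ · (Q(a^{(m)})ζ(5) − P(a^{(m)}))`,
the summands being Brown–Zudilin's own eliminants `partnerElim (a^{(m)}) i` at the consecutive diagonal translates of `a`
(E-L10 `partnerElim_eq`, E-L12 `diagElim_iterate_eq_partnerElim`).  Down-shifts and mixed shifts are the cases
`a = b″` resp. `a ∉ {b′, b″}`. -/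
theorem slice_elim_mem_partnerSpan {b' b'' : ℕ → ℤ} (hb' : InBox b') (hb'' : InBox b'') (h0 : b' 0 = b'' 0)
    (hoff : ∀ j, 8 ≤ j → b' j = b'' j) (hd' : -1 ≤ dOf b') (hd'' : -1 ≤ dOf b'')
    {i : ℕ} (hi : i ∈ range 7) (hli : meet b' b'' (i + 1) ≤ meet b' b'' 0)
    (hW : ∀ m, 0 < m → m < meetDepth b' b'' → coeffW (dsShift^[m] (meet b' b'')) ≠ 0) :
    pairElim b' b'' ∈
      Submodule.span ℚ ((fun m => partnerElim (dsShift^[m] (meet b' b'')) i) ''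
        (range (meetDepth b' b'') : Finset ℕ)) := by
  obtain ⟨h1, h2, hp, hq⟩ := meet_paths hb' hb'' h0 hoff hd' hd''
  have hN : ((max (pathOf (meet b' b'') b').length (pathOf (meet b' b'') b'').length : ℕ) : ℤ) ≤
      dOf (meet b' b'') + 1 := by
    have := meetDepth_eq h0 hoff
    unfold meetDepth at this
    rw [this]
    have := (dOf_le_dOf_meet (b' := b') (b'' := b'') h0).1
    rcases le_total (dOf b') (dOf b'') with h | h
    · rw [min_eq_left h]; omega
    · rw [min_eq_right h]; omega
  have h := upCone_elim_mem_partnerSpan hp hq hN hi hli hW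
  rwa [h1, h2] at h

/-- **Down-shift pairs are contiguous pairs read from below**: `E(a + e_{i+1}, a) = −partnerElim a i`
(so the pair `(b, b − e_{i+1})` is Brown–Zudilin's own pair at the base `b − e_{i+1}`; definitional, cf. E-L13
`contiguous_eq_pair`). -/
theorem pairElim_up_base (a : ℕ → ℤ) (i : ℕ) : pairElim (up a i) a = -partnerElim a i := by
  rw [pairElim_swap, ← (contiguous_eq_pair a i).2.2.2]

/-! ### Rank remark (honest framing): what the span statements are worth -/

/-- CRAMER: two-term forms `Q₀ξ − P₀`, `Q₁ξ − P₁` with `Q₀P₁ ≠ Q₁P₀` in a `ℚ`-submodule `S ≤ ℝ` put EVERY rational `Aξ − B`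
in `S` — so at depth `N ≥ 2` span membership of a `ζ(3)`-eliminant is automatic (module docstring, RANK REMARK). -/
theorem twoTerm_mem_of_pair_mem {S : Submodule ℚ ℝ} {ξ : ℝ} {Q₀ P₀ Q₁ P₁ : ℚ} (h₀ : (Q₀ : ℝ) * ξ - P₀ ∈ S)
    (h₁ : (Q₁ : ℝ) * ξ - P₁ ∈ S) (hC : Q₀ * P₁ - Q₁ * P₀ ≠ 0) (A B : ℚ) : (A : ℝ) * ξ - B ∈ S := by
  have hC' : (Q₀ : ℝ) * P₁ - Q₁ * P₀ ≠ 0 := by exact_mod_cast hC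
  have h := S.add_mem (S.smul_mem ((A * P₁ - Q₁ * B) / (Q₀ * P₁ - Q₁ * P₀)) h₀)
    (S.smul_mem ((Q₀ * B - A * P₀) / (Q₀ * P₁ - Q₁ * P₀)) h₁)
  convert h using 1; rw [Rat.smul_def, Rat.smul_def]; push_cast
  rw [div_mul_eq_mul_div, div_mul_eq_mul_div, ← add_div, eq_div_iff hC']; ring

/-- Hence for ANY two points `b′, b″` of the decomposition region — no partner relation, no (DS), any parity of `b″₀ − b′₀` —
and any box point `a` with `d(a) ≥ 1`, an admissible slot and `Q(a)P(a⁺) − Q(a⁺)P(a) ≠ 0` (E-L12's diagonal minors):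
`W(b″)F̃₇(b′) − W(b′)F̃₇(b″) ∈ ⟨diagElim a, diagElim a⁺⟩_ℚ = diagSpan a 2`.  The up-cone theorems are to be read through
their identities (`flag_expansion`, `pairElim_upList`, `secondShell_elim_eq`), not through the membership. -/
theorem pairElim_mem_diagSpan_two_of_casoratian {a b' b'' : ℕ → ℤ} (ha : InBox a) (hd : 1 ≤ dOf a) {i : ℕ}
    (hi : i ∈ range 7) (hli : a (i + 1) ≤ a 0)
    (hC : diagMinorQ a * diagMinorP (dsShift a) - diagMinorQ (dsShift a) * diagMinorP a ≠ 0)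
    (hb' : InBox b') (hs' : ∑ j ∈ range 7, b' (j + 1) ≤ 3 * b' 0 + 1)
    (hb'' : InBox b'') (hs'' : ∑ j ∈ range 7, b'' (j + 1) ≤ 3 * b'' 0 + 1) :
    pairElim b' b'' ∈ diagSpan a 2 := by
  have h₀ := diagElim_mem_diagSpan a (m := 0) (N := 2) (by norm_num)
  have h₁ := diagElim_mem_diagSpan a (m := 1) (N := 2) (by norm_num)
  rw [Function.iterate_zero_apply, diagElim_eq_diagMinors a ha (by omega) hi hli] at h₀
  rw [Function.iterate_one, diagElim_eq_diagMinors (dsShift a) (inBox_dsShift ha) (by rw [dOf_dsShift]; omega) hi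
    (by rw [dsShift_succ, dsShift_zero]; omega)] at h₁
  rw [pairElim_eq b' b'' hb' hs' hb'' hs'']; exact twoTerm_mem_of_pair_mem h₀ h₁ hC _ _


/-! ### Pairs at EVEN distance `2r` in the leading entry -/

/-- Undo `r` diagonal steps: `lower r x = x − r·(2; 1, …, 1)`. -/
def lower (r : ℕ) (x : ℕ → ℤ) : ℕ → ℤ := fun j => if j = 0 then x 0 - 2 * r else x j - r

/-- The base for a pair at even distance: `a = b′ ∧ (b″ − r·(2; 1, …, 1))`. -/
def shiftMeet (r : ℕ) (b' b'' : ℕ → ℤ) : ℕ → ℤ := meet b' (lower r b'')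

/-- Its depth: `N = max(|pathOf a b′|, |pathOf a^{(r)} b″| + r)`. -/
def shiftDepth (r : ℕ) (b' b'' : ℕ → ℤ) : ℕ :=
  max (pathOf (shiftMeet r b' b'') b').length ((pathOf (dsShift^[r] (shiftMeet r b' b'')) b'').length + r)

/-- `wedge_expand` with two coefficient families on each side:
`(Σ_l d_l W₂(l))(Σ_k c_k F₁(k)) − (Σ_k c_k W₁(k))(Σ_l d_l F₂(l)) = Σ_k Σ_l c_k d_l (W₂(l)F₁(k) − W₁(k)F₂(l))`. -/
theorem wedge_expand₂ {R : Type*} [CommRing R] (s t : ℕ) (c d W₁ F₁ W₂ F₂ : ℕ → R) :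
    (∑ l ∈ range t, d l * W₂ l) * (∑ k ∈ range s, c k * F₁ k) -
        (∑ k ∈ range s, c k * W₁ k) * (∑ l ∈ range t, d l * F₂ l) =
      ∑ k ∈ range s, ∑ l ∈ range t, c k * d l * (W₂ l * F₁ k - W₁ k * F₂ l) := by
  have h1 : (∑ l ∈ range t, d l * W₂ l) * (∑ k ∈ range s, c k * F₁ k) =
      ∑ k ∈ range s, ∑ l ∈ range t, c k * d l * (W₂ l * F₁ k) := by
    rw [Finset.sum_mul_sum, Finset.sum_comm]
    exact Finset.sum_congr rfl fun k _ => Finset.sum_congr rfl fun l _ => by ring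
  have h2 : (∑ k ∈ range s, c k * W₁ k) * (∑ l ∈ range t, d l * F₂ l) =
      ∑ k ∈ range s, ∑ l ∈ range t, c k * d l * (W₁ k * F₂ l) := by
    rw [Finset.sum_mul_sum]
    exact Finset.sum_congr rfl fun k _ => Finset.sum_congr rfl fun l _ => by ring
  rw [h1, h2, ← Finset.sum_sub_distrib]
  refine Finset.sum_congr rfl fun k _ => ?_
  rw [← Finset.sum_sub_distrib]
  exact Finset.sum_congr rfl fun l _ => by ring

/-- Two flags at one base `a`, the second started `r` diagonal steps up: the eliminant of the two expanded points lies in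
`⟨diagElim a^{(m)} : m < N⟩_ℚ` as soon as `s ≤ N + 1` and `t + r ≤ N + 1` (given the pivots). -/
theorem twoFlag_elim_mem_diagSpan (a : ℕ → ℤ) {s t r N : ℕ} (c d : ℕ → ℚ) (hs : s ≤ N + 1) (ht : t + r ≤ N + 1)
    (hW : ∀ m, 0 < m → m < N → coeffW (dsShift^[m] a) ≠ 0) :
    (∑ l ∈ range t, (d l : ℝ) * (coeffW (dsShift^[l + r] a) : ℝ)) *
          (∑ k ∈ range s, (c k : ℝ) * vwpDual 7 (dsShift^[k] a)) -
        (∑ k ∈ range s, (c k : ℝ) * (coeffW (dsShift^[k] a) : ℝ)) *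
          (∑ l ∈ range t, (d l : ℝ) * vwpDual 7 (dsShift^[l + r] a)) ∈ diagSpan a N := by
  rw [wedge_expand₂]
  refine Submodule.sum_mem _ fun k hk => Submodule.sum_mem _ fun l hl => ?_
  have hk' : k ≤ N := by have := mem_range.1 hk; omega
  have hl' : l + r ≤ N := by have := mem_range.1 hl; omega
  have h := ratMul_mem_diagSpan a (c k * d l) (pairElim_iterate_iterate_mem_diagSpan a hk' hl' hW)
  convert h using 1
  unfold pairElim; push_cast; ring

/-- **PAIRS AT EVEN DISTANCE IN `b₀`.** For `b′, b″` in the box with `b″₀ = b′₀ + 2r`, `b″ ≥ r` on the slots (so that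
`b″ − r·(2;1,…,1)` is still a box shape below `b″`), `b″ ≡ b′ + r` beyond slot 7 (inert entries), `d(b′), d(b″) ≥ −1`, the
base `a = shiftMeet r b′ b″` and pivots `W(a^{(m)}) ≠ 0`, `0 < m < N = shiftDepth r b′ b″`:
`W(b″)F̃₇(b′) − W(b′)F̃₇(b″) ∈ ⟨diagElim a^{(m)} : m < N⟩_ℚ` — `b′ = upList a p` and `b″ = upList a^{(r)} q` are two flags at
ONE base.  The case `r = 0` (`lower 0 = id`) is `slice_elim_mem_diagSpan`. -/
theorem shifted_elim_mem_diagSpan (r : ℕ) {b' b'' : ℕ → ℤ} (hb' : InBox b') (hb'' : InBox b'')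
    (h0 : b'' 0 = b' 0 + 2 * r) (hsub : ∀ j ∈ range 7, (r : ℤ) ≤ b'' (j + 1))
    (hoff : ∀ j, 8 ≤ j → b'' j = b' j + r) (hd' : -1 ≤ dOf b') (hd'' : -1 ≤ dOf b'')
    (hW : ∀ m, 0 < m → m < shiftDepth r b' b'' → coeffW (dsShift^[m] (shiftMeet r b' b'')) ≠ 0) :
    pairElim b' b'' ∈ diagSpan (shiftMeet r b' b'') (shiftDepth r b' b'') := by
  unfold shiftDepth at hW ⊢
  set a := shiftMeet r b' b'' with ha_def
  -- the base lies in the box, below `b′` and (after `r` diagonal steps) below `b″`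
  have ha0 : a 0 = b' 0 := meet_zero _ _
  have hasucc : ∀ j ∈ range 7, a (j + 1) = min (b' (j + 1)) (b'' (j + 1) - r) := fun j hj => by
    rw [ha_def, shiftMeet, meet_succ _ _ hj]; simp [lower]
  have haoff : ∀ j, 8 ≤ j → a j = b' j := fun j hj => meet_of_le _ _ hj
  have ha : InBox a := by
    refine ⟨by rw [ha0]; exact hb'.1, fun j hj => ?_⟩
    rw [hasucc j hj, ha0]
    obtain ⟨h1, h2⟩ := hb'.2 j hj
    exact ⟨le_min h1 (by have := hsub j hj; omega), (min_le_left _ _).trans h2⟩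
  have hle' : ∀ j ∈ range 7, a (j + 1) ≤ b' (j + 1) := fun j hj => by rw [hasucc j hj]; exact min_le_left _ _
  have h1 : upList a (pathOf a b') = b' := upList_pathOf ha0 hle' haoff
  have hp : PathAdm a (pathOf a b') := pathAdm_pathOf ha hb' ha0 hle' haoff hd'
  have hr0 : (dsShift^[r] a) 0 = b'' 0 := by rw [iterate_dsShift_zero, ha0, h0]
  have hrle : ∀ j ∈ range 7, (dsShift^[r] a) (j + 1) ≤ b'' (j + 1) := fun j hj => by
    rw [iterate_dsShift_succ, hasucc j hj]
    have := min_le_right (b' (j + 1)) (b'' (j + 1) - r)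
    omega
  have hroff : ∀ j, 8 ≤ j → (dsShift^[r] a) j = b'' j := fun j hj => by
    obtain ⟨k, rfl⟩ : ∃ k, j = k + 1 := ⟨j - 1, by omega⟩
    rw [iterate_dsShift_succ, haoff _ hj, hoff _ hj]
  have h2 : upList (dsShift^[r] a) (pathOf (dsShift^[r] a) b'') = b'' := upList_pathOf hr0 hrle hroff
  have hq : PathAdm (dsShift^[r] a) (pathOf (dsShift^[r] a) b'') :=
    pathAdm_pathOf (inBox_iterate_dsShift ha r) hb'' hr0 hrle hroff hd''
  -- expand both points along their flags and collect
  have eW' := coeffW_upList hp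
  have eF' := vwpDual_upList hp
  rw [h1] at eW' eF'
  have eW'' := coeffW_upList hq
  have eF'' := vwpDual_upList hq
  rw [h2] at eW'' eF''
  simp only [← Function.iterate_add_apply] at eW'' eF''
  unfold pairElim
  rw [eW'', eF', eW', eF'']
  push_cast
  exact twoFlag_elim_mem_diagSpan a (flagCoeff a (pathOf a b')) (flagCoeff (dsShift^[r] a) (pathOf (dsShift^[r] a) b''))
    (by omega) (by omega) hW

/-- The depth formula survives: `N = d(a) − min(d(b′), d(b″))` for `a = shiftMeet r b′ b″` (now with `b″₀ = b′₀ + 2r`). -/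
theorem shiftDepth_eq (r : ℕ) {b' b'' : ℕ → ℤ} (h0 : b'' 0 = b' 0 + 2 * r) (hoff : ∀ j, 8 ≤ j → b'' j = b' j + r) :
    (shiftDepth r b' b'' : ℤ) = dOf (shiftMeet r b' b'') - min (dOf b') (dOf b'') := by
  unfold shiftDepth
  set a := shiftMeet r b' b'' with ha_def
  have ha0 : a 0 = b' 0 := meet_zero _ _
  have hasucc : ∀ j ∈ range 7, a (j + 1) = min (b' (j + 1)) (b'' (j + 1) - r) := fun j hj => by
    rw [ha_def, shiftMeet, meet_succ _ _ hj]; simp [lower]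
  have haoff : ∀ j, 8 ≤ j → a j = b' j := fun j hj => meet_of_le _ _ hj
  have hle' : ∀ j ∈ range 7, a (j + 1) ≤ b' (j + 1) := fun j hj => by rw [hasucc j hj]; exact min_le_left _ _
  have hr0 : (dsShift^[r] a) 0 = b'' 0 := by rw [iterate_dsShift_zero, ha0, h0]
  have hrle : ∀ j ∈ range 7, (dsShift^[r] a) (j + 1) ≤ b'' (j + 1) := fun j hj => by
    rw [iterate_dsShift_succ, hasucc j hj]
    have := min_le_right (b' (j + 1)) (b'' (j + 1) - r)
    omega
  have hroff : ∀ j, 8 ≤ j → (dsShift^[r] a) j = b'' j := fun j hj => by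
    obtain ⟨k, rfl⟩ : ∃ k, j = k + 1 := ⟨j - 1, by omega⟩
    rw [iterate_dsShift_succ, haoff _ hj, hoff _ hj]
  have e1 := length_pathOf ha0 hle' haoff
  have e2 := length_pathOf hr0 hrle hroff
  rw [dOf_iterate_dsShift] at e2
  push_cast
  rw [e1, e2]
  rcases le_total (dOf b') (dOf b'') with h | h
  · rw [min_eq_left h, max_eq_left (by omega)]
  · rw [min_eq_right h, max_eq_right (by omega)]; omega

end Summit.KontsevichZagierPeriods.Zeta5Search.Elimination
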